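import Mathlib
import Summits.Ventures.DiscreteObjects.Mahler.FourTermMeasureBound
import Summits.Ventures.DiscreteObjects.Mahler.OddCoefficientsCyclotomicFactors

/-!
# Sparse reciprocal polynomials IV: cyclotomic factors of `x^{p+q} ± 2x^p ± 2x^q ± 1`
(venture `DiscreteObjects`, target L)

Cell `pub-namedobj`, seat `pub-namedobj-mahler-g24`. Framing: lottery ticket; floor = certified
bounds/negative ranges.

For `P = x^{p+q} + b x^p + s b x^q + s` with `|b| = 2` (`b = 2ε`, `0 < p < q`, `s = ±1`, `k = q - p`,
`n = p + q`) the norm argument of `FourTermCyclotomicFactors` leaves a second possibility: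

* `cyclotomic_dvd_or_of_dvd_quadrinomial_two` — a cyclotomic factor `Φ_r` of `P` divides EITHER
  `x^k + s` (type A, as for `|b| ≥ 3`) OR `xⁿ - s` (type B: `|Res(Φ_r, xⁿ + s)| = 2^{φ(r)}` forces
  `|ζⁿ + s| = 2`, i.e. `ζⁿ = s`, at every primitive `r`-th root of unity `ζ`);
* `dvd_X_pow_add_and_sub_of_dvd` — type A factors also divide `xⁿ + s` and `x^{2p} - 1` (any `b`);
* `cyclotomic_dvd_of_typeB` — type B factors divide `x^{2p} + sε x^p + 1` and `x^{3p} - sε`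
  (`ζ^p + ζ^{-p} = -sε`);
* `not_cyclotomic_sq_dvd_of_typeB` — type B factors are SIMPLE (from `P'(ζ) = 0` one would get
  `(p - q) Im ζ^p = 0`, but `ζ^p` is a primitive cube or sixth root of unity);
* `dvd_X_pow_gcd_sub_C` — Euclid on exponents: `F ∣ x^a - u`, `F ∣ x^c - v` (`u, v = ±1`) give
  `F ∣ x^{gcd(a,c)} - w` for some `w = ±1` (used to bound the degrees of the cyclotomic parts).

The assembly (`P = C_A C_B Q`, `deg C_A ≤ gcd(k, 2p)`, `deg C_B ≤ gcd(n, 3p)`, and the bound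
`M(P) ≥ 2^{1/4}` resp. the kernel ladder for `n < 10 gcd(n, p)`) is in `FourTermAbsTwo`.
In print: [Dobrowolski2006] E. Dobrowolski, Acta Arith. 123 (2006), Prop. 2 (`M(f) ≥ θ₀` for every monic
quadrinomial with `f(0) ≠ 0` not a product of cyclotomics); its proof treats `a = 2` by the same doubling
`2 ∣ α^{m+n} + η ⇒ 2 ∣ α^{m+n} - η`.  This file is a kernel formalisation of that case (REPLICATION; the
type A / type B bookkeeping is ours).
-/

namespace Summit.Ventures.DiscreteObjects.Mahler

open Polynomial

/-- If a multiset of reals in `[0, c]` (`c > 0`) has product `c^{card}`, every element equals `c`. -/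
theorem eq_of_prod_map_eq_pow_card {ι : Type*} {R : Multiset ι} {f : ι → ℝ} {c : ℝ} (hc : 0 < c)
    (h0 : ∀ x ∈ R, 0 ≤ f x) (hle : ∀ x ∈ R, f x ≤ c) (hprod : (R.map f).prod = c ^ Multiset.card R) :
    ∀ x ∈ R, f x = c := by
  intro x hx
  by_contra hne
  have hlt : f x < c := lt_of_le_of_ne (hle x hx) hne
  obtain ⟨R', hR'⟩ := Multiset.exists_cons_of_mem hx
  have hsub : ∀ y ∈ R', y ∈ R := fun y hy => by rw [hR']; exact Multiset.mem_cons_of_mem hy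
  have hrest : (R'.map f).prod ≤ c ^ Multiset.card R' := by
    calc (R'.map f).prod ≤ (R'.map fun _ => c).prod :=
          Multiset.prod_map_le_prod_map₀ _ _ (fun y hy => h0 y (hsub y hy)) (fun y hy => hle y (hsub y hy))
      _ = c ^ Multiset.card R' := by rw [Multiset.map_const', Multiset.prod_replicate]
  rw [hR', Multiset.map_cons, Multiset.prod_cons, Multiset.card_cons, pow_succ'] at hprod
  have h1 : f x * (R'.map f).prod ≤ f x * c ^ Multiset.card R' :=
    mul_le_mul_of_nonneg_left hrest (h0 x hx)
  have h2 : f x * c ^ Multiset.card R' < c * c ^ Multiset.card R' :=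
    mul_lt_mul_of_pos_right hlt (pow_pos hc _)
  linarith

/-- **Euclid on exponents.** If `F ∣ x^a - u` and `F ∣ x^c - v` in `ℤ[X]` with `u, v = ±1` and
`a, c > 0`, then `F ∣ x^{gcd(a,c)} - w` for some `w = ±1`
(`x^a - u - x^{a-c}(x^c - v) = v (x^{a-c} - uv)`). -/
theorem dvd_X_pow_gcd_sub_C {F : ℤ[X]} : ∀ (m a c : ℕ) (u v : ℤ), a + c ≤ m → 0 < a → 0 < c →
    (u = 1 ∨ u = -1) → (v = 1 ∨ v = -1) → F ∣ (X ^ a - C u : ℤ[X]) → F ∣ (X ^ c - C v : ℤ[X]) →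
    ∃ w : ℤ, (w = 1 ∨ w = -1) ∧ F ∣ (X ^ (Nat.gcd a c) - C w : ℤ[X]) := by
  intro m
  induction m using Nat.strong_induction_on with
  | _ m ih =>
    intro a c u v hm ha hc hu hv hFa hFc
    -- the reduction step `(a, c) ↦ (a - c, c)` for `c < a`
    have step : ∀ (a c : ℕ) (u v : ℤ), a + c ≤ m → 0 < a → 0 < c → c < a → (u = 1 ∨ u = -1) →
        (v = 1 ∨ v = -1) → F ∣ (X ^ a - C u : ℤ[X]) → F ∣ (X ^ c - C v : ℤ[X]) →
        ∃ w : ℤ, (w = 1 ∨ w = -1) ∧ F ∣ (X ^ (Nat.gcd a c) - C w : ℤ[X]) := by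
      intro a c u v hm ha hc hca hu hv hFa hFc
      have hvv : v * v = 1 := by rcases hv with h | h <;> simp [h]
      have hCv : (C v : ℤ[X]) * C v = 1 := by rw [← map_mul, hvv, map_one]
      have hF' : F ∣ (X ^ (a - c) - C (u * v) : ℤ[X]) := by
        have e : (X ^ (a - c) - C (u * v) : ℤ[X]) = C v * ((X ^ a - C u) - X ^ (a - c) * (X ^ c - C v)) := by
          obtain ⟨d, rfl⟩ : ∃ d, a = c + d := ⟨a - c, by omega⟩
          rw [Nat.add_sub_cancel_left, map_mul, pow_add]
          linear_combination (-(X ^ d : ℤ[X])) * hCv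
        rw [e]
        exact dvd_mul_of_dvd_right (dvd_sub hFa (dvd_mul_of_dvd_right hFc _)) _
      have huv : u * v = 1 ∨ u * v = -1 := by
        rcases hu with h | h <;> rcases hv with h' | h' <;> simp [h, h']
      obtain ⟨w, hw, hdvd⟩ := ih (a - c + c) (by omega) (a - c) c (u * v) v le_rfl (by omega) hc huv hv hF' hFc
      refine ⟨w, hw, ?_⟩
      rwa [Nat.gcd_sub_self_left hca.le] at hdvd
    rcases lt_trichotomy c a with hca | hca | hca
    · exact step a c u v hm ha hc hca hu hv hFa hFc
    · subst hca; exact ⟨u, hu, by rwa [Nat.gcd_self]⟩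
    · obtain ⟨w, hw, hdvd⟩ := step c a v u (by omega) hc ha hca hv hu hFc hFa
      exact ⟨w, hw, by rwa [Nat.gcd_comm]⟩

section Quadrinomial

variable {p q : ℕ} {b s : ℤ}

/-- `x^{p+q} + s = P - (b s) x^p (x^{q-p} + s)` for the quadrinomial `P` (uses `s² = 1`). -/
theorem X_pow_add_C_eq_quadrinomial_sub (hpq : p < q) (hs : s = 1 ∨ s = -1) (b : ℤ) :
    (X ^ (p + q) + C s : ℤ[X]) = (X ^ (p + q) + C b * X ^ p + C (s * b) * X ^ q + C s)
      - C (b * s) * (X ^ p * (X ^ (q - p) + C s)) := by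
  have hss : s * s = 1 := by rcases hs with h | h <;> simp [h]
  have hCs : (C s : ℤ[X]) * C s = 1 := by rw [← map_mul, hss, map_one]
  obtain ⟨k, rfl⟩ : ∃ k, q = p + k := ⟨q - p, by omega⟩
  rw [Nat.add_sub_cancel_left, map_mul, map_mul]
  linear_combination (C b * X ^ p) * hCs

/-- A common factor of the quadrinomial and of `x^{q-p} + s` divides `x^{p+q} + s` and `x^{2p} - 1`
(any `b`; for `|b| ≥ 3` every cyclotomic factor is of this type). -/
theorem dvd_X_pow_add_and_sub_of_dvd (hpq : p < q) (hs : s = 1 ∨ s = -1) {F : ℤ[X]}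
    (hF : F ∣ (X ^ (p + q) + C b * X ^ p + C (s * b) * X ^ q + C s : ℤ[X]))
    (hW : F ∣ (X ^ (q - p) + C s : ℤ[X])) :
    F ∣ (X ^ (p + q) + C s : ℤ[X]) ∧ F ∣ (X ^ (2 * p) - 1 : ℤ[X]) := by
  have hss : s * s = 1 := by rcases hs with h | h <;> simp [h]
  have hCs : (C s : ℤ[X]) * C s = 1 := by rw [← map_mul, hss, map_one]
  have h1 : F ∣ (X ^ (p + q) + C s : ℤ[X]) := by
    rw [X_pow_add_C_eq_quadrinomial_sub hpq hs b]
    exact dvd_sub hF (dvd_mul_of_dvd_right (dvd_mul_of_dvd_right hW _) _)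
  refine ⟨h1, ?_⟩
  have e2 : (X ^ (2 * p) - 1 : ℤ[X]) = C s * (X ^ (2 * p) * (X ^ (q - p) + C s) - (X ^ (p + q) + C s)) := by
    obtain ⟨k, rfl⟩ : ∃ k, q = p + k := ⟨q - p, by omega⟩
    rw [Nat.add_sub_cancel_left]
    linear_combination (1 - X ^ (2 * p) : ℤ[X]) * hCs
  rw [e2]
  exact dvd_mul_of_dvd_right (dvd_sub (dvd_mul_of_dvd_right hW _) h1) _

/-- A point `w` of the unit circle with `|w + s| = 2` (`s = ±1`) is `w = s`. -/
theorem eq_of_norm_eq_one_of_norm_add_sign {w : ℂ} (hw : ‖w‖ = 1) (hs : s = 1 ∨ s = -1)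
    (h2 : ‖w + (s : ℂ)‖ = 2) : w = (s : ℂ) := by
  rcases hs with h | h
  · subst h
    have h' : ‖-w - 1‖ = 2 := by rw [show -w - 1 = -(w + ((1 : ℤ) : ℂ)) by push_cast; ring, norm_neg, h2]
    have := eq_neg_one_of_norm_eq_one_of_norm_sub_one (by rw [norm_neg, hw]) h'
    push_cast; linear_combination -this
  · subst h
    have h' : ‖w - 1‖ = 2 := by rw [show w - 1 = w + ((-1 : ℤ) : ℂ) by push_cast; ring, h2]
    have := eq_neg_one_of_norm_eq_one_of_norm_sub_one hw h'
    push_cast; exact this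

/-- **Cyclotomic factors of the quadrinomial, `|b| = 2`: two types.**  If `Φ_r ∣ P` with `b = ±2` then
`Φ_r ∣ x^{q-p} + s` (type A) or `Φ_r ∣ x^{p+q} - s` (type B).  Proof: with `W = x^{q-p} + s`,
`Res(Φ_r, xⁿ + s) = (-bs)^{φ(r)} Res(Φ_r, x^p W)`; if the second resultant is nonzero, the first has
modulus `≥ 2^{φ(r)}`, so every primitive `r`-th root of unity `ζ` has `|ζⁿ + s| = 2`, i.e. `ζⁿ = s`. -/
theorem cyclotomic_dvd_or_of_dvd_quadrinomial_two (hp : 0 < p) (hpq : p < q) (hs : s = 1 ∨ s = -1)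
    (hb : b = 2 ∨ b = -2) {r : ℕ} (hr : 0 < r)
    (hdvd : cyclotomic r ℤ ∣ (X ^ (p + q) + C b * X ^ p + C (s * b) * X ^ q + C s : ℤ[X])) :
    cyclotomic r ℤ ∣ (X ^ (q - p) + C s : ℤ[X]) ∨ cyclotomic r ℤ ∣ (X ^ (p + q) - C s : ℤ[X]) := by
  set Φ : ℤ[X] := cyclotomic r ℤ with hΦ
  set n := p + q with hn
  have hΦm : Φ.Monic := cyclotomic.monic r ℤ
  have hΦ0 : Φ ≠ 0 := hΦm.ne_zero
  have hdpos : 0 < Φ.natDegree := by rw [natDegree_cyclotomic]; exact Nat.totient_pos.mpr hr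
  obtain ⟨H, hH⟩ := hdvd
  have hH0 : H ≠ 0 := by
    intro h0
    have := (quadrinomial_monic_natDegree hp hpq b s).1.ne_zero
    rw [hH, h0, mul_zero] at this
    exact this rfl
  have hHdeg : H.natDegree + Φ.natDegree = n := by
    have h := (quadrinomial_monic_natDegree hp hpq b s).2
    rw [hH, natDegree_mul hΦ0 hH0] at h
    omega
  have hG : (X ^ n + C s : ℤ[X]) = C (-(b * s)) * (X ^ p * (X ^ (q - p) + C s)) + Φ * H := by
    rw [← hH, X_pow_add_C_eq_quadrinomial_sub hpq hs b, map_neg]; ring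
  have hGdeg : (X ^ n + C s : ℤ[X]).natDegree ≤ n := by rw [natDegree_X_pow_add_C]
  have hTdeg : (X ^ p * (X ^ (q - p) + C s) : ℤ[X]).natDegree ≤ n := by
    refine natDegree_mul_le.trans ?_
    rw [natDegree_X_pow, natDegree_X_pow_add_C]; omega
  have hres : Φ.resultant (X ^ n + C s) Φ.natDegree n =
      (-(b * s)) ^ Φ.natDegree * Φ.resultant (X ^ p * (X ^ (q - p) + C s)) Φ.natDegree n := by
    rw [hG, resultant_add_mul_right Φ (C (-(b * s)) * (X ^ p * (X ^ (q - p) + C s))) H Φ.natDegree n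
      (by omega) le_rfl, resultant_C_mul_right]
  -- roots of `Φ` over `ℂ`
  have hinj : Function.Injective (Int.castRingHom ℂ) := (Int.castRingHom ℂ).injective_int
  have hcard : Multiset.card (Φ.map (Int.castRingHom ℂ)).roots = Φ.natDegree := by
    have hsp := (IsAlgClosed.splits (Φ.map (Int.castRingHom ℂ))).natDegree_eq_card_roots
    rw [natDegree_map_eq_of_injective hinj] at hsp
    exact hsp.symm
  have hlc : (Φ.map (Int.castRingHom ℂ)).leadingCoeff = 1 := by
    rw [leadingCoeff_map_of_injective hinj, hΦm.leadingCoeff, map_one]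
  have hrootΦ : ∀ ζ ∈ (Φ.map (Int.castRingHom ℂ)).roots, IsPrimitiveRoot ζ r := by
    intro ζ hζ
    have h := (mem_roots'.mp hζ).2
    rw [hΦ, map_cyclotomic] at h
    haveI : NeZero (r : ℂ) := ⟨by exact_mod_cast hr.ne'⟩
    exact isRoot_cyclotomic_iff.mp h
  have hevalG : ∀ ζ : ℂ, ((X ^ n + C s : ℤ[X]).map (Int.castRingHom ℂ)).eval ζ = ζ ^ n + (s : ℂ) := by
    intro ζ
    simp only [Polynomial.map_add, Polynomial.map_pow, map_X, eq_intCast, Polynomial.map_intCast,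
      eval_add, eval_pow, eval_X, eval_intCast]
  by_cases hzero : Φ.resultant (X ^ p * (X ^ (q - p) + C s)) Φ.natDegree n = 0
  · -- type A: a common root of `Φ` and `x^p W`
    left
    have hC := resultant_intCast_eq (f := Φ) hTdeg
    rw [hzero, Int.cast_zero, hlc, one_pow, one_mul] at hC
    obtain ⟨w, hw, hw0⟩ := Multiset.prod_eq_zero_iff.mp hC.symm |> Multiset.mem_map.mp
    have hζ := hrootΦ w hw
    have hw1 : ‖w‖ = 1 := hζ.norm'_eq_one hr.ne'
    have hwne : w ≠ 0 := fun h => by rw [h, norm_zero] at hw1; exact zero_ne_one hw1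
    have hWw : aeval w (X ^ (q - p) + C s : ℤ[X]) = 0 := by
      simp only [Polynomial.map_mul, Polynomial.map_pow, map_X, eval_mul, eval_pow, eval_X] at hw0
      rcases mul_eq_zero.mp hw0 with h | h
      · exact absurd (pow_eq_zero_iff (by omega) |>.mp h) hwne
      · rwa [eval_map, ← algebraMap_int_eq, ← aeval_def] at h
    rw [hΦ, cyclotomic_eq_minpoly hζ hr]
    exact minpoly.isIntegrallyClosed_dvd (hζ.isIntegral hr) hWw
  · -- type B: `∏ |ζⁿ + s| = 2^{φ(r)}`, so each `ζⁿ = s`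
    right
    have hbs : |(-(b * s))| = (2 : ℤ) := by
      rcases hb with h | h <;> rcases hs with h' | h' <;> simp [h, h']
    have hlow : (2 : ℝ) ^ Φ.natDegree ≤ ‖((Φ.resultant (X ^ n + C s) Φ.natDegree n : ℤ) : ℂ)‖ := by
      rw [Complex.norm_intCast]
      have h1 : (1 : ℤ) ≤ |Φ.resultant (X ^ p * (X ^ (q - p) + C s)) Φ.natDegree n| := Int.one_le_abs hzero
      have h2 : (2 : ℤ) ^ Φ.natDegree ≤ |Φ.resultant (X ^ n + C s) Φ.natDegree n| := by
        rw [hres, abs_mul, abs_pow, hbs]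
        calc (2 : ℤ) ^ Φ.natDegree = 2 ^ Φ.natDegree * 1 := by ring
          _ ≤ 2 ^ Φ.natDegree * |Φ.resultant (X ^ p * (X ^ (q - p) + C s)) Φ.natDegree n| :=
              mul_le_mul_of_nonneg_left h1 (by positivity)
      exact_mod_cast h2
    rw [resultant_intCast_eq hGdeg, hlc, one_pow, one_mul] at hlow
    have hmp := map_multiset_prod (normHom : ℂ →*₀ ℝ)
      (((Φ.map (Int.castRingHom ℂ)).roots.map ((X ^ n + C s : ℤ[X]).map (Int.castRingHom ℂ)).eval))
    rw [Multiset.map_map] at hmp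
    simp only [normHom_apply, Function.comp_def] at hmp
    rw [hmp] at hlow
    have hle2 : ∀ ζ ∈ (Φ.map (Int.castRingHom ℂ)).roots,
        ‖((X ^ n + C s : ℤ[X]).map (Int.castRingHom ℂ)).eval ζ‖ ≤ 2 := by
      intro ζ hζ
      rw [hevalG]
      have h1 : ‖ζ‖ = 1 := (hrootΦ ζ hζ).norm'_eq_one hr.ne'
      calc ‖ζ ^ n + (s : ℂ)‖ ≤ ‖ζ ^ n‖ + ‖(s : ℂ)‖ := norm_add_le _ _
        _ ≤ 1 + 1 := add_le_add (by rw [norm_pow, h1, one_pow]) (norm_intCast_le_one_of_sign hs)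
        _ = 2 := by norm_num
    have hup : ((Φ.map (Int.castRingHom ℂ)).roots.map
        (fun ζ => ‖((X ^ n + C s : ℤ[X]).map (Int.castRingHom ℂ)).eval ζ‖)).prod ≤ 2 ^ Φ.natDegree := by
      calc ((Φ.map (Int.castRingHom ℂ)).roots.map
            (fun ζ => ‖((X ^ n + C s : ℤ[X]).map (Int.castRingHom ℂ)).eval ζ‖)).prod
          ≤ ((Φ.map (Int.castRingHom ℂ)).roots.map (fun _ => (2 : ℝ))).prod :=
            Multiset.prod_map_le_prod_map₀ _ _ (fun ζ _ => norm_nonneg _) hle2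
        _ = 2 ^ Φ.natDegree := by rw [Multiset.map_const', Multiset.prod_replicate, hcard]
    have heq := le_antisymm hup hlow
    rw [← hcard] at heq
    have hall := eq_of_prod_map_eq_pow_card (by norm_num : (0 : ℝ) < 2) (fun ζ _ => norm_nonneg _) hle2 heq
    -- pick a root `ζ`; it has `ζⁿ = s`
    have hne : (Φ.map (Int.castRingHom ℂ)).roots ≠ 0 := by
      intro h; rw [h, Multiset.card_zero] at hcard; omega
    obtain ⟨ζ, hζ⟩ := Multiset.exists_mem_of_ne_zero hne
    have hprim := hrootΦ ζ hζ
    have hζ1 : ‖ζ‖ = 1 := hprim.norm'_eq_one hr.ne'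
    have h2 := hall ζ hζ
    rw [hevalG] at h2
    have hζn : ζ ^ n = (s : ℂ) := eq_of_norm_eq_one_of_norm_add_sign (by rw [norm_pow, hζ1, one_pow]) hs h2
    have haev : aeval ζ (X ^ n - C s : ℤ[X]) = 0 := by
      simp only [map_sub, map_pow, aeval_X, eq_intCast, map_intCast, hζn, sub_self]
    rw [hΦ, cyclotomic_eq_minpoly hprim hr]
    exact minpoly.isIntegrallyClosed_dvd (hprim.isIntegral hr) haev

/-- **Type B factors** (`b = 2ε`, `Φ_r ∣ P`, `Φ_r ∣ xⁿ - s`): `Φ_r ∣ x^{2p} + sε x^p + 1` and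
`Φ_r ∣ x^{3p} - sε`.  (`P - (xⁿ - s) = 2U` with `U = ε x^p + εs x^q + s`, `Φ_r` is prime and does not
divide `2`, `x^p U = ε(x^{2p} + sεx^p + 1) + εs(xⁿ - s)`, and `(x^p - sε)(x^{2p} + sεx^p + 1) = x^{3p} - sε`.) -/
theorem cyclotomic_dvd_of_typeB (hs : s = 1 ∨ s = -1) {ε : ℤ} (hε : ε = 1 ∨ ε = -1)
    (hb : b = 2 * ε) {r : ℕ} (hr : 0 < r)
    (hdvd : cyclotomic r ℤ ∣ (X ^ (p + q) + C b * X ^ p + C (s * b) * X ^ q + C s : ℤ[X]))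
    (hB : cyclotomic r ℤ ∣ (X ^ (p + q) - C s : ℤ[X])) :
    cyclotomic r ℤ ∣ (X ^ (2 * p) + C (s * ε) * X ^ p + 1 : ℤ[X]) ∧
      cyclotomic r ℤ ∣ (X ^ (3 * p) - C (s * ε) : ℤ[X]) := by
  set Φ : ℤ[X] := cyclotomic r ℤ with hΦ
  have hss : s * s = 1 := by rcases hs with h | h <;> simp [h]
  have hεε : ε * ε = 1 := by rcases hε with h | h <;> simp [h]
  have hCs : (C s : ℤ[X]) * C s = 1 := by rw [← map_mul, hss, map_one]
  have hCε : (C ε : ℤ[X]) * C ε = 1 := by rw [← map_mul, hεε, map_one]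
  have hprime : Prime Φ := (cyclotomic.irreducible hr).prime
  -- `Φ ∣ U`
  set U : ℤ[X] := C ε * X ^ p + C (ε * s) * X ^ q + C s with hU
  have hPU : (X ^ (p + q) + C b * X ^ p + C (s * b) * X ^ q + C s : ℤ[X]) - (X ^ (p + q) - C s) = C 2 * U := by
    rw [hU, hb]; simp only [map_mul, map_ofNat]; ring
  have h2U : Φ ∣ C 2 * U := by rw [← hPU]; exact dvd_sub hdvd hB
  have hU' : Φ ∣ U := by
    rcases hprime.dvd_or_dvd h2U with h | h
    · exfalso
      have hd := natDegree_le_of_dvd h (by simp)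
      rw [natDegree_C, hΦ, natDegree_cyclotomic] at hd
      have := Nat.totient_pos.mpr hr
      omega
    · exact h
  -- `Φ ∣ Y`
  have hY : Φ ∣ (X ^ (2 * p) + C (s * ε) * X ^ p + 1 : ℤ[X]) := by
    have e : (X ^ (2 * p) + C (s * ε) * X ^ p + 1 : ℤ[X]) =
        C ε * (X ^ p * U) - C (ε * s) * C ε * (X ^ (p + q) - C s) := by
      rw [hU]; simp only [map_mul]
      linear_combination (-(X ^ (2 * p) + 1 : ℤ[X])) * hCε + (-(C ε * C ε)) * hCs
    rw [e]
    exact dvd_sub (dvd_mul_of_dvd_right (dvd_mul_of_dvd_right hU' _) _) (dvd_mul_of_dvd_right hB _)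
  refine ⟨hY, ?_⟩
  have e3 : (X ^ (3 * p) - C (s * ε) : ℤ[X]) = (X ^ p - C (s * ε)) * (X ^ (2 * p) + C (s * ε) * X ^ p + 1) := by
    simp only [map_mul]
    linear_combination (X ^ p * (C ε * C ε)) * hCs + (X ^ p) * hCε
  rw [e3]
  exact dvd_mul_of_dvd_right hY _

/-- **Type B factors are simple.**  If `Φ_r ∣ xⁿ - s` and `Φ_r ∣ x^{2p} + sε x^p + 1` (type B) then
`Φ_r² ∤ P`: at a primitive `r`-th root of unity `ζ`, `w = ζ^p` is a primitive cube or sixth root of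
unity (`w² + sε w + 1 = 0`, so `Im w ≠ 0`), `ζ^q = s w̄`, and `P'(ζ) = 0` would give
`b (p Im w + s q Im(s w̄)) = b (p - q) Im w = 0`. -/
theorem not_cyclotomic_sq_dvd_of_typeB (hp : 0 < p) (hpq : p < q) (hs : s = 1 ∨ s = -1) {ε : ℤ}
    (hε : ε = 1 ∨ ε = -1) (hb : b = 2 * ε) {r : ℕ} (hr : 0 < r)
    (hB : cyclotomic r ℤ ∣ (X ^ (p + q) - C s : ℤ[X]))
    (hY : cyclotomic r ℤ ∣ (X ^ (2 * p) + C (s * ε) * X ^ p + 1 : ℤ[X])) :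
    ¬ cyclotomic r ℤ * cyclotomic r ℤ ∣ (X ^ (p + q) + C b * X ^ p + C (s * b) * X ^ q + C s : ℤ[X]) := by
  intro hdvd
  set Φ : ℤ[X] := cyclotomic r ℤ with hΦ
  set P : ℤ[X] := X ^ (p + q) + C b * X ^ p + C (s * b) * X ^ q + C s with hP
  have hss : s * s = 1 := by rcases hs with h | h <;> simp [h]
  have hb0 : b ≠ 0 := by rcases hε with h | h <;> simp [hb, h]
  -- a primitive r-th root of unity
  set ζ : ℂ := Complex.exp (2 * Real.pi * Complex.I / r) with hζdef
  have hprim : IsPrimitiveRoot ζ r := Complex.isPrimitiveRoot_exp r (by omega)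
  have hζ1 : ‖ζ‖ = 1 := hprim.norm'_eq_one hr.ne'
  have hΦζ : aeval ζ Φ = 0 := by
    have h := hprim.isRoot_cyclotomic hr (R := ℂ)
    rw [IsRoot.def, ← map_cyclotomic_int, eval_map] at h
    rwa [aeval_def, algebraMap_int_eq]
  have aeval_of_dvd : ∀ {F : ℤ[X]}, Φ ∣ F → aeval ζ F = 0 := by
    intro F hF; obtain ⟨R, hR⟩ := hF; rw [hR, map_mul, hΦζ, zero_mul]
  have hn : ζ ^ (p + q) = (s : ℂ) := by
    have h := aeval_of_dvd hB
    simp only [map_sub, map_pow, aeval_X, eq_intCast, map_intCast] at h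
    exact sub_eq_zero.mp h
  set w : ℂ := ζ ^ p with hw
  have hw1 : ‖w‖ = 1 := by rw [hw, norm_pow, hζ1, one_pow]
  have hwY : w ^ 2 + (s : ℂ) * ε * w + 1 = 0 := by
    have h := aeval_of_dvd hY
    simp only [map_add, map_mul, map_pow, aeval_X, eq_intCast, map_intCast, map_one] at h
    rw [hw, ← pow_mul, mul_comm p 2]; exact h
  -- `ζ^q = s * conj w`
  have hwne : w ≠ 0 := fun h => by rw [h, norm_zero] at hw1; exact zero_ne_one hw1
  have hq : ζ ^ q = (s : ℂ) * (starRingEnd ℂ) w := by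
    have h1 : w * ζ ^ q = (s : ℂ) := by rw [hw, ← pow_add, hn]
    rw [← Complex.inv_eq_conj hw1]
    field_simp
    linear_combination h1
  -- `Φ ∣ P'`, the derivative equation at `ζ`, multiplied by `ζ`
  have hder : Φ ∣ derivative P := by
    obtain ⟨R, hR⟩ := hdvd
    rw [hR, mul_assoc, derivative_mul]
    exact dvd_add ((dvd_mul_right Φ R).mul_left _) (dvd_mul_right _ _)
  have hder' : derivative P = C ((p + q : ℕ) : ℤ) * X ^ (p + q - 1) + C (b * (p : ℤ)) * X ^ (p - 1) +
      C (s * b * (q : ℤ)) * X ^ (q - 1) := by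
    rw [hP]
    simp only [derivative_add, derivative_X_pow, derivative_C_mul_X_pow, derivative_C, add_zero]
  have hE := aeval_of_dvd hder
  rw [hder'] at hE
  simp only [map_add, map_mul, map_pow, aeval_X, eq_intCast, map_intCast, map_natCast] at hE
  have hE' : ((p + q : ℕ) : ℂ) * ζ ^ (p + q) + b * p * ζ ^ p + s * b * q * ζ ^ q = 0 := by
    have e1 : ζ ^ (p + q) = ζ * ζ ^ (p + q - 1) := (mul_pow_sub_one (by omega) ζ).symm
    have e2 : ζ ^ p = ζ * ζ ^ (p - 1) := (mul_pow_sub_one (by omega) ζ).symm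
    have e3 : ζ ^ q = ζ * ζ ^ (q - 1) := (mul_pow_sub_one (by omega) ζ).symm
    rw [e1, e2, e3]
    linear_combination ζ * hE
  rw [hn, hq, ← hw] at hE'
  -- imaginary parts: `b (p - q) Im w = 0`
  have him := congrArg Complex.im hE'
  simp only [Complex.add_im, Complex.mul_im, Complex.mul_re, Complex.natCast_re, Complex.natCast_im,
    Complex.intCast_re, Complex.intCast_im, Complex.conj_re, Complex.conj_im, Complex.zero_im,
    zero_mul, mul_zero, add_zero, sub_zero, zero_add] at him
  have hs2 : (s : ℝ) * s = 1 := by exact_mod_cast hss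
  have hkey : ((b : ℝ) * ((p : ℝ) - q)) * w.im = 0 := by
    linear_combination him + ((b : ℝ) * q * w.im) * hs2
  have hpq' : (p : ℝ) - q ≠ 0 := by
    have : (p : ℝ) < q := by exact_mod_cast hpq
    linarith
  have hb0' : (b : ℝ) ≠ 0 := by exact_mod_cast hb0
  have hwim : w.im = 0 := by
    rcases mul_eq_zero.mp hkey with h | h
    · rcases mul_eq_zero.mp h with h' | h'
      · exact absurd h' hb0'
      · exact absurd h' hpq'
    · exact h
  -- but `w² + sε w + 1 = 0` has no real solution
  have hre := congrArg Complex.re hwY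
  simp only [Complex.add_re, Complex.mul_re, Complex.mul_im, sq, Complex.intCast_re, Complex.intCast_im,
    Complex.one_re, Complex.zero_re, hwim, mul_zero, sub_zero, zero_mul, add_zero] at hre
  have hsε : (s : ℝ) * ε = 1 ∨ (s : ℝ) * ε = -1 := by
    rcases hs with h | h <;> rcases hε with h' | h' <;> simp [h, h']
  rcases hsε with h | h <;> rw [h] at hre <;> nlinarith [sq_nonneg (2 * w.re + 1), sq_nonneg (2 * w.re - 1)]

end Quadrinomial

end Summit.Ventures.DiscreteObjects.Mahler
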